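import Summits.AtomisticToContinuum.Crystallization.Theses.ReggeStarCoercivity
import Summits.AtomisticToContinuum.Crystallization.Theorems.DefectFreeCrystallizes.Negative.PredicateAPI
import Literature.MathematicalPhysics.StatisticalMechanics.LennardJonesClusters
import Literature.MathematicalPhysics.StatisticalMechanics.BarlowStacking

/-!
# Crux `ReggeStarCoercivity.DefectFreeCrystallizes` (stmt-AtomisticToContinuum-13603), line `prestress-split-korn`:
# definitions (D-0016: the objects and statement blocks the line posits; proofs live in the sibling stub files)

The line (lead's skeleton `Cruxes/DefectFreeCrystallizes/Lines/prestress-split-korn.lean`, idea card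
`Cruxes/DefectFreeCrystallizes/Ideas/prestress-split-korn.md`) proves the crux
`ZeroDefectDensity → IsCrystallizing lennardJones 3` as the composition
S1 `TiltedWells` → S2 `FunnelRigidity` → S3 `LocalTemplate` → S4 (`SplitClosure`: the three give
`SplitCoercivity`) → S5 (`SqueezeClosure`, split as `LayeredGluing` + `LayeredGluing → SqueezeClosure`) →
S6 `HullMinimality.PeriodicGivenLayered` → S7 `HullMinimality.HullCriterion` → crux.  Every registered stub
is landed under `Theorems/ReggeStarCoercivityDefectFreeCrystallizes<Stub>.lean` in this namespace
(`stub_tiltedWells`, `stub_hullCriterion` already landed) and must state its signature over IMPORTABLE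
vocabulary; this file is that vocabulary, verbatim from the checked skeleton:

* objects: `layeredPos a s z (m,i,j)` — the generic point `i·u(a) + j·v(a) + haggLabel s m·w(a) + z m·e₃` of the
  layered sets of `HullMinimality.LayeredWindows` / `PeriodicGivenLayered` (stmt-11778/11779), as a LABELLED map
  (free heights `z`; `barlowPos a h s m i j` is the uniform-height case `z m = m h`); `idealHeights m = m √(2/3)`;
* predicates: `InBox a z` (relaxation box `a ∈ [47/50, 1]`, increments in `[39a/50, 17a/20]`, the box of the cone's
  items 11778/11779/13958), `ClusterClose τ T y l` (the unit cluster of label `l` is mapped `τμ`-close, label by label,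
  to a similar copy of the template cluster), `LayeredNear η x i` (the 2-ball of particle `i` is two-way `η`-matched to
  a rigid image of a box template);
* statement blocks (Props, one per stub, no parameters): `TiltedWells`, `FunnelRigidity`, `LocalTemplate`,
  `PrestressSplit`, `SplitCoercivity`, `LayeredOfZeroDefects`, `LayeredGluing`, and the implication names `SplitClosure`,
  `SqueezeClosure`.  `SplitCoercivity` is written over the Literature `siteEnergy` (so the line's site energy is
  `½·siteEnergy lennardJones x i`) and the periodic infimum `⨅ Q, Q.energyPerParticle lennardJones` inline.

Nothing here asserts anything; `Good` / `defects` are the crux's own sub-expressions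
(`Theorems.DefectFreeCrystallizes.Negative.PredicateAPI`, `defectFreeCrystallizes_iff` is `Iff.rfl`).
-/

noncomputable section

open scoped BigOperators Classical InnerProductSpace
open Filter Topology

namespace Summit.AtomisticToContinuum.Crystallization.Theorems.PrestressSplitKorn

open Summit.AtomisticToContinuum.Crystallization.Theses
open Summit.AtomisticToContinuum.Crystallization.Theses.ReggeStarCoercivity
open Summit.AtomisticToContinuum.Crystallization.Theorems.DefectFreeCrystallizes.Negative.PredicateAPI
open Literature.MathematicalPhysics.StatisticalMechanics Literature.Geometry.DiscreteGeometry

local notation "E3" => EuclideanSpace ℝ (Fin 3)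

/-! ## Vocabulary (transparent abbreviations of expressions already used by the cone's items) -/

/-- Site `(m, i, j)` of the LAYERED TEMPLATE with in-layer spacing `a`, Hägg word `s` and free layer
heights `z` — verbatim the generic element of the set `S` in `HullMinimality.LayeredWindows` (stmt-11778)
and in 11779 / 13958, written as a labelled map so that deformations can be indexed by labels. -/
def layeredPos (a : ℝ) (s : ℤ → ℤ) (z : ℤ → ℝ) (l : ℤ × ℤ × ℤ) : E3 :=
  ((l.2.1 : ℝ) • triangularVec₁ a) + ((l.2.2 : ℝ) • triangularVec₂ a) +
    ((haggLabel s l.1 : ℝ) • barlowOffset a) + (z l.1 • layerNormal 1)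

/-- The ideal layer heights `m ↦ m·√(2/3)` (touching-ball stacking at `a = 1`; increments in the box
`[39/50, 17/20]`). -/
def idealHeights (m : ℤ) : ℝ := (m : ℝ) * Real.sqrt (2 / 3)

/-- The relaxation box of the cone (route PoissonBesselStacking box B, used by 11778/11779/13958):
`a ∈ [47/50, 1]`, every interlayer increment in `[39a/50, 17a/20]`. -/
def InBox (a : ℝ) (z : ℤ → ℝ) : Prop :=
  47 / 50 ≤ a ∧ a ≤ 1 ∧ ∀ m : ℤ, 39 / 50 * a ≤ z (m + 1) - z m ∧ z (m + 1) - z m ≤ 17 / 20 * a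

/-- The IDEAL template is a box template: `a = 1` and every interlayer increment equals `√(2/3) ∈ [39/50, 17/20]`
(`0.78² = 0.6084 ≤ 2/3 ≤ 0.7225 = 0.85²`). Registered anchor `inBox_idealHeights` of this definitions file. -/
theorem inBox_idealHeights : InBox 1 idealHeights := by
  have h1 : (39 / 50 : ℝ) ≤ Real.sqrt (2 / 3) := by
    rw [show (39 / 50 : ℝ) = Real.sqrt ((39 / 50) ^ 2) by rw [Real.sqrt_sq]; norm_num]
    exact Real.sqrt_le_sqrt (by norm_num)
  have h2 : Real.sqrt (2 / 3) ≤ (17 / 20 : ℝ) := by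
    rw [show (17 / 20 : ℝ) = Real.sqrt ((17 / 20) ^ 2) by rw [Real.sqrt_sq]; norm_num]
    exact Real.sqrt_le_sqrt (by norm_num)
  refine ⟨by norm_num, le_rfl, fun m => ?_⟩
  have : idealHeights (m + 1) - idealHeights m = Real.sqrt (2 / 3) := by
    simp only [idealHeights]; push_cast; ring
  rw [this]
  exact ⟨by linarith, by linarith⟩

/-- The 2-ball of particle `i` is two-way `η`-matched, after a translation, to a rigid image of a layered
template in the box (verbatim the local predicate of PhononSlackCertificates.NearFieldConvexity, stmt-13958). -/
def LayeredNear {N : ℕ} (η : ℝ) (x : Fin N → E3) (i : Fin N) : Prop :=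
  ∃ (A : E3 →ₗᵢ[ℝ] E3) (t : E3) (a : ℝ) (s : ℤ → ℤ) (z : ℤ → ℝ), InBox a z ∧ IsHaggSeq s ∧
    let S : Set E3 := Set.range fun l : ℤ × ℤ × ℤ => A (layeredPos a s z l)
    (∀ j : Fin N, dist (x j) (x i) ≤ 2 → ∃ p ∈ S, dist (x j + t) p ≤ η) ∧
      (∀ p ∈ S, dist p (x i + t) ≤ 2 → ∃ j : Fin N, dist (x j + t) p ≤ η)

/-- FUNNEL CLOSENESS (tolerance `τ`) of a deformation `y` of the template `T` at label `l`: the unit cluster of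
`l` (template neighbours within `6/5`, i.e. exactly the twelve struts for every box template) is mapped
`τ·μ`-close, label by label, to a similar copy — scale `μ ∈ [17/20, 6/5]`, isometry `A ∈ O(3)`. With `τ = 1/20`
and the ideal template this is VERBATIM the crux's goodness of the site read through a labelling (S3 delivers it);
S2 consumes the looser `τ = 1/12`, which survives replacing the ideal template by the relaxed one of the same word. -/
def ClusterClose (τ : ℝ) (T y : ℤ × ℤ × ℤ → E3) (l : ℤ × ℤ × ℤ) : Prop :=
  ∃ (A : E3 →ₗᵢ[ℝ] E3) (μ : ℝ), 17 / 20 ≤ μ ∧ μ ≤ 6 / 5 ∧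
    ∀ l' : ℤ × ℤ × ℤ, dist (T l') (T l) ≤ 6 / 5 → dist (y l' - y l) (μ • A (T l' - T l)) ≤ τ * μ

/-! ## The five statement blocks of the line -/

/-- **S1 — tilted Lennard-Jones wells (calculus; numbers in the line card).** With the bond tension per
squared length `ω(r*) = V'(r*)/(2r*) = (r*⁻⁷ − r*⁻¹³)/(2r*)` of a reference bond of length `r*`, the tilted
well `Ṽ(r) = V(r) − ω(r*)·r²` satisfies: (a) STRUTS NEAR THE RELAXED REFERENCE (`r* ∈ [24/25, 49/50]`, the in-plane
and interlayer first-shell lengths 0.9714 / 0.9697 of the relaxed stackings): `Ṽ(r) − Ṽ(r*) ≥ (59/20)(r − r*)²` on the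
one-shell band `r ∈ [9/10, 21/20]` (numerical min 3.009 at `(r, r*) = (21/20, 49/50)`; 5.46 at `r = r* = 0.9714`) — the
clause the budget `|ω₁|·K + τ < c'` is read with (`|ω₁| ≤ 0.135`, `K ≤ 16` from S2: `2.95 > 2.16 + τ`);
(b) STRUTS ON THE WHOLE FUNNEL (`r* ∈ [19/20, 1]`, `r ∈ [4/5, 6/5]`): modulus `≥ 7/8` (min 0.9216 at `(6/5, 1)`) — single
welled with NO convexity radius, the large-distortion regime being priced with O(1) margins; (c) CABLES (`r* ≥ 6/5`,
`ω > 0`, concave tail): `Ṽ(r) − Ṽ(r*) ≥ −(11/2)·r*⁻⁸·(r − r*)²` for `|r − r*| ≤ r*/10` (numerical sup of the tax 5.195 —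
the pure `−r⁻⁶/6` limit at 10 % compression; 2.96 at the √2-shell). Numerics: planner folder calc/wells.py. -/
def TiltedWells : Prop :=
  (∀ rs r : ℝ, 24 / 25 ≤ rs → rs ≤ 49 / 50 → 9 / 10 ≤ r → r ≤ 21 / 20 →
      (59 / 20 : ℝ) * (r - rs) ^ 2 ≤
        lennardJones r - lennardJones rs - (rs⁻¹ ^ 7 - rs⁻¹ ^ 13) / (2 * rs) * (r ^ 2 - rs ^ 2)) ∧
  (∀ rs r : ℝ, 19 / 20 ≤ rs → rs ≤ 1 → 4 / 5 ≤ r → r ≤ 6 / 5 →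
      (7 / 8 : ℝ) * (r - rs) ^ 2 ≤
        lennardJones r - lennardJones rs - (rs⁻¹ ^ 7 - rs⁻¹ ^ 13) / (2 * rs) * (r ^ 2 - rs ^ 2)) ∧
  (∀ rs r : ℝ, 6 / 5 ≤ rs → |r - rs| ≤ rs / 10 →
      -(11 / 2 : ℝ) * rs⁻¹ ^ 8 * (r - rs) ^ 2 ≤
        lennardJones r - lennardJones rs - (rs⁻¹ ^ 7 - rs⁻¹ ^ 13) / (2 * rs) * (r ^ 2 - rs ^ 2))

/-- **S2 — nonlinear interior rigidity of the Barlow contact frameworks in the funnel (potential-free).**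
One constant `K ≤ 16` (the bet: twice the linear Bloch floor 8) for every box template `T = layeredPos a s z` (any Hägg
word, free heights): for every deformation `y` of the labels that is funnel-close (`ClusterClose (1/12)`) at every label
of the template ball
`B_R(c)`, `R ≥ 4`, there is ONE linear isometry `Q` with
`Σ_{struts in B_{R/2}(c)} ‖(y l' − y l) − Q(T l' − T l)‖² ≤ K · Σ_{struts in B_R(c)} (|y l' − y l| − |T l' − T l|)²`
(struts = template pairs at distance ≤ 6/5; true stretches on the right, no linearisation). Intended proof:
cellwise rigidity of the (near-regular) tetrahedra and octahedra of the template + a geometric-rigidity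
(Friesecke–James–Müller / F. John) estimate on their face-connected union, constant scale-invariant and
uniform in the word because only two cell shapes occur; the linear Bloch value `sup λ_max(L)/λ_min(A) = 8`
(fcc and hcp, Disproof numerics calc/korn.py) is the infinitesimal floor of `K`. -/
def FunnelRigidity : Prop :=
  ∃ K : ℝ, 0 < K ∧ K ≤ 16 ∧ ∀ (a : ℝ) (s : ℤ → ℤ) (z : ℤ → ℝ), InBox a z → IsHaggSeq s →
    ∀ (y : ℤ × ℤ × ℤ → E3) (c : E3) (R : ℝ), 4 ≤ R →
    ∀ (L Lh : Finset (ℤ × ℤ × ℤ)),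
      (∀ l, l ∈ L ↔ dist (layeredPos a s z l) c ≤ R) →
      (∀ l, l ∈ Lh ↔ dist (layeredPos a s z l) c ≤ R / 2) →
      (∀ l ∈ L, ClusterClose (1 / 12) (layeredPos a s z) y l) →
      ∃ Q : E3 →ₗᵢ[ℝ] E3,
        (∑ l ∈ Lh, ∑ l' ∈ Lh.filter (fun l' => l' ≠ l ∧ dist (layeredPos a s z l') (layeredPos a s z l) ≤ 6 / 5),
            ‖(y l' - y l) - Q (layeredPos a s z l' - layeredPos a s z l)‖ ^ 2) ≤
          K * ∑ l ∈ L, ∑ l' ∈ L.filter (fun l' => l' ≠ l ∧ dist (layeredPos a s z l') (layeredPos a s z l) ≤ 6 / 5),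
            (dist (y l') (y l) - dist (layeredPos a s z l') (layeredPos a s z l)) ^ 2

/-- **S3 — robust LOCAL template for the crux predicate (potential-free geometry).** If every particle within
`3R` of particle `i` of an injective finite configuration is crux-GOOD (`PredicateAPI.Good`: 6/5-shell
1/20-close to fcc/hcp at a scale in `[9/10, 11/10]`), then there are a Hägg word `s`, a centre `c` and a
deformation `y` of the IDEAL template `layeredPos 1 s idealHeights` such that: template labels in `B_R(c)` are
carried to particles, every particle within `R/2` of `x i` is such an image, and `y` is funnel-close on every
unit cluster of the template ball (the word is consistent on the ball because two non-parallel hcp-type sheets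
meeting `B_{6R/5}` would cross inside the good region `B_{3R}`; type of a good site is unambiguous by the landed
`Negative.TypeGap`). -/
def LocalTemplate : Prop :=
  ∀ (R : ℝ), 4 ≤ R → ∀ (N : ℕ) (x : Fin N → E3), Function.Injective x → ∀ i : Fin N,
    (∀ j : Fin N, dist (x j) (x i) ≤ 3 * R → Good x j) →
    ∃ (s : ℤ → ℤ) (c : E3) (y : ℤ × ℤ × ℤ → E3), IsHaggSeq s ∧
      (∀ l, dist (layeredPos 1 s idealHeights l) c ≤ R → ∃ j : Fin N, y l = x j) ∧
      (∀ j : Fin N, dist (x j) (x i) ≤ R / 2 → ∃ l, dist (layeredPos 1 s idealHeights l) c ≤ R ∧ y l = x j) ∧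
      Set.InjOn y {l | dist (layeredPos 1 s idealHeights l) c ≤ R} ∧
      (∀ l, dist (layeredPos 1 s idealHeights l) c ≤ R → ClusterClose (1 / 20) (layeredPos 1 s idealHeights) y l)

/-- **The coercivity interface delivered by the engine (S4) and consumed by the squeeze (S5).** For every
separation `δ` and tolerance `η` there is a charge `c > 0` (independent of `θ`!) such that for every mesoscopic
slack `θ > 0` there are a depth `ρ` and a boundary constant `C` with: for every `δ`-separated finite `x` and
every set `Ω` of particles whose `ρ`-neighbourhoods are entirely crux-good,
`c·#{i ∈ Ω : 2-ball not η-layered} − C·#{i ∈ Ω : within ρ of a particle outside Ω} − θ·#Ω ≤ Σ_{i∈Ω} (e_i − e*)`.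
Shape of PhononSlackCertificates.NearFieldConvexity (13958) for the crux's own predicate, weakened by the
`θ`-slack that the mesoscopic localisation of the split's boundary flux costs (see line card, Flux). -/
def SplitCoercivity : Prop :=
  ∀ δ : ℝ, 0 < δ → ∀ η : ℝ, 0 < η → ∃ c : ℝ, 0 < c ∧ ∀ θ : ℝ, 0 < θ → ∃ ρ C : ℝ, 0 < ρ ∧
    ∀ (N : ℕ) (x : Fin N → E3), (∀ i j : Fin N, i ≠ j → δ ≤ dist (x i) (x j)) →
    ∀ Ω : Finset (Fin N), (∀ i ∈ Ω, ∀ j : Fin N, dist (x j) (x i) ≤ ρ → Good x j) →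
      c * ((Ω.filter fun i => ¬ LayeredNear η x i).card : ℝ)
          - C * ((Ω.filter fun i => ∃ j : Fin N, j ∉ Ω ∧ dist (x j) (x i) ≤ ρ).card : ℝ)
          - θ * (Ω.card : ℝ)
        ≤ ∑ i ∈ Ω, ((1 / 2 : ℝ) * siteEnergy lennardJones x i -
            ⨅ Q : PeriodicConfiguration 3, Q.energyPerParticle lennardJones)

/-- **Output of the squeeze: layered windows for a defect-free sequence** — per ground-state sequence, the
crux's antecedent (with `PredicateAPI.defects`, verbatim the crux's count) implies the conclusion of
`HullMinimality.LayeredWindows` (stmt-11778) for that sequence, i.e. exactly the hypothesis of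
`HullMinimality.PeriodicGivenLayered` (stmt-11779). (= card own-word-squeeze's `DefectFreeLayered`.) -/
def LayeredOfZeroDefects : Prop :=
  ∀ x : (N : ℕ) → (Fin N → E3), (∀ N, IsGroundState lennardJones (x N)) →
    Tendsto (fun N : ℕ => (defects (x N) : ℝ) / N) atTop (𝓝 0) →
    ∃ a : ℝ, 47 / 50 ≤ a ∧ a ≤ 1 ∧ ∀ R ε : ℝ, 0 < ε → ∃ᶠ N in Filter.atTop,
      ∃ (A : E3 →ₗᵢ[ℝ] E3) (t : E3) (s : ℤ → ℤ) (z : ℤ → ℝ), IsHaggSeq s ∧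
        (∀ m : ℤ, 39 / 50 * a ≤ z (m + 1) - z m ∧ z (m + 1) - z m ≤ 17 / 20 * a) ∧
        let S : Set E3 := {p | ∃ m i j : ℤ, p = A (((i : ℝ) • triangularVec₁ a) +
          ((j : ℝ) • triangularVec₂ a) + ((haggLabel s m : ℝ) • barlowOffset a) + (z m • layerNormal 1))}
        (∀ p ∈ S, ‖p‖ ≤ R → ∃ i : Fin N, dist (x N i + t) p ≤ ε) ∧
          (∀ i : Fin N, ‖x N i + t‖ ≤ R → ∃ p ∈ S, dist (x N i + t) p ≤ ε)

/-- **S4a — THE PRESTRESS SPLIT (exact algebraic identity; the engine's first lemma).** Writing every pair term as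
a well of the squared bond length, `V(|b|) = W(|b|²)`, with symmetric per-bond tensions `ω` and a reference `y`:
`Σ_{i,j}[W(|b|²) − W(|ē|²)] = Σ_{i,j}[W̃(b) − W̃(ē)] + Σ_{i,j} ω|b − ē|² − 4 Σ_i ⟪F_i, u_i⟫`, where `W̃(v) = W(|v|²) − ω|v|²`
are the TILTED wells, `b = x j − x i`, `ē = y j − y i`, `u = x − y`, and `F_i = Σ_j ω i j (y j − y i)` the reference forces
(so the linear term is a boundary flux wherever the reference is balanced). For Lennard-Jones `ω = W′(|ē|²)`; struts
(`ω < 0`) are estimated by S1/S2, cables (`ω > 0`) dropped, the flux by zero stress (S4). -/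
def PrestressSplit : Prop :=
  ∀ (n : ℕ) (W : Fin n → Fin n → ℝ → ℝ) (ω : Fin n → Fin n → ℝ), (∀ i j, ω i j = ω j i) →
      ∀ x y : Fin n → EuclideanSpace ℝ (Fin 3),
        ∑ i, ∑ j, (W i j (‖x j - x i‖ ^ 2) - W i j (‖y j - y i‖ ^ 2)) =
          ∑ i, ∑ j, ((W i j (‖x j - x i‖ ^ 2) - ω i j * ‖x j - x i‖ ^ 2) -
              (W i j (‖y j - y i‖ ^ 2) - ω i j * ‖y j - y i‖ ^ 2)) +
            ∑ i, ∑ j, ω i j * ‖(x j - x i) - (y j - y i)‖ ^ 2 -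
              4 * ∑ i, ⟪∑ j, ω i j • (y j - y i), x i - y i⟫_ℝ

/-- **S4 as a named obligation**: the engine's closure
`PrestressSplit → TiltedWells → FunnelRigidity → LocalTemplate → SplitCoercivity` (S4a, S1, S2, S3 ⊢ coercivity). -/
def SplitClosure : Prop :=
  PrestressSplit → TiltedWells → FunnelRigidity → LocalTemplate → SplitCoercivity

/-- **S5 as a named obligation**: the squeeze `SplitCoercivity → LayeredOfZeroDefects`. -/
def SqueezeClosure : Prop :=
  SplitCoercivity → LayeredOfZeroDefects

/-- **THE GLUING LEMMA (S5a, potential-free discrete geometry).** For every separation `δ` and every scale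
`(R, ε)` there are a tolerance `η > 0` and a radius `R'` such that: if every particle within `R'` of particle `i`
of a `δ`-separated finite configuration is crux-good AND `η`-layered-near (`LayeredNear η`), then, after a
translation, the configuration is two-way `ε`-matched on `B(0, R)` with ONE rigid image of ONE box template
(the format of `HullMinimality.LayeredWindows` at radius `R`). Mechanism: overlapping `η`-layered 2-balls agree
on their overlaps (letters, registry, heights); words and heights glue along the normal; in-plane frames drift by
`≤ C·R'·η` (`η ~ ε/(C R²)`, `R' ~ 3R + C`: two non-parallel hcp-type sheets meeting `B(R)` cross inside
`B(R')`); the increment box is restored by an `O(Rη)` clipping of the glued heights. Alternative proof: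
compactness of `δ`-separated point sets in the local matching topology + EXACT (η = 0) local-to-global
rigidity of layered sets. -/
def LayeredGluing : Prop :=
  ∀ δ : ℝ, 0 < δ → ∀ R ε : ℝ, 0 < ε → ∃ η : ℝ, 0 < η ∧ ∃ R' : ℝ,
    ∀ (N : ℕ) (x : Fin N → E3), (∀ i j : Fin N, i ≠ j → δ ≤ dist (x i) (x j)) →
    ∀ i : Fin N, (∀ j : Fin N, dist (x j) (x i) ≤ R' → Good x j ∧ LayeredNear η x j) →
      ∃ (A : E3 →ₗᵢ[ℝ] E3) (t : E3) (a : ℝ) (s : ℤ → ℤ) (z : ℤ → ℝ), InBox a z ∧ IsHaggSeq s ∧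
        let S : Set E3 := Set.range fun l : ℤ × ℤ × ℤ => A (layeredPos a s z l)
        (∀ p ∈ S, ‖p‖ ≤ R → ∃ j : Fin N, dist (x j + t) p ≤ ε) ∧
          (∀ j : Fin N, ‖x j + t‖ ≤ R → ∃ p ∈ S, dist (x j + t) p ≤ ε)

end Summit.AtomisticToContinuum.Crystallization.Theorems.PrestressSplitKorn

end
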